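import Literature.Analysis.FluidPDE.FiniteFourierModeEulerGeneric

/-!
# Kishimoto–Yoneda, §4: edges of `S^{conv}` through a vertex, in the language of functionals

Support file for `FiniteFourierModeEuler` (N. Kishimoto, T. Yoneda, J. Math. Fluid Mech. 24
(2022) 74 = arXiv:2110.08039). The proof of Theorem 4.1 moves along EDGES of the polyhedron
`S^{conv}` (Lemma 4.5, Prop. 4.4 (ii),(iii), the propagation arguments in the proofs of
Props. 4.4 and 4.7, and the side `E` in the proof of Prop. 4.8). We avoid building the face
lattice of a polytope and PROVE the needed existence statements directly with linear functionals
`x ↦ w · x` on the finite set `S ⊂ ℝ³`: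

* `exists_exposed_edge_up` (**an edge from a vertex towards larger `g`**): if `v ∈ S` is exposed
  by `φ` (strict maximiser) and does not maximise `g` on `S`, then for `λ* = min λ_s`,
  `λ_s = (φ v - φ s)/(g s - g v)` over `g s > g v`, the functional `ψ = φ + λ* g` is maximised on
  `S` exactly at `v` and at points `s` with `g s > g v`; this is the edge of `S^{conv}` at `v`
  leaving in the direction of increasing `g` (the simplex-method step; it gives the connectivity
  of the vertex–edge graph used implicitly in the proofs of Props. 4.4 and 4.7);
* `exists_strict_max_perturb` (**perturbation**): the unique `g`-maximiser of the face `argmax_S ψ` is the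
  unique maximiser of `ψ + ε g` on `S` for small `ε > 0` (so it is a vertex);
* `sip_endpoint_next`, `sip_endpoint_second` (**Lemma 4.5, combinatorial part**): on an exposed
  collinear set `E ∩ S = {n₁, n₂, …}` ordered from the endpoint `n₁`, the pairs `(n₁, n₂)` and
  `(n₁, n₃)` are simply interacting ("the two segments have the common middle point … by the
  definition of `n₁, n₂` it must hold that `{n₁, n₂} = {n', n''}`"; "it is only `n₂` that is in
  `S ∩ E` and between `n₁, n₃`").

## References

* [KishimotoYoneda2022] N. Kishimoto, T. Yoneda, J. Math. Fluid Mech. 24 (2022) 74 =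
  arXiv:2110.08039, §4 Lemma 4.5 (proof), Prop. 4.4 (proof), Prop. 4.8 (proof).
-/

noncomputable section

open Matrix Finset

namespace Literature.Analysis.FluidPDE

namespace KY

/-! ### An edge from an exposed vertex in the direction of increasing `g` -/

/-- **The edge of `S^{conv}` at an exposed vertex `v` leaving towards larger `g`.** If `φ` is
strictly maximal on `S` at `v` and some point of `S` has larger `g` than `v`, there are `λ* > 0`
and `w ∈ S` with `g w > g v` such that `ψ = φ + λ* g` satisfies `ψ s ≤ ψ v` on `S`, `ψ w = ψ v`,
and `ψ s = ψ v` only for `s = v` or `g s > g v`. [cite: KishimotoYoneda2022, §4 (proofs of Props. 4.4, 4.7: "propagates to adjacent vertices")] -/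
theorem exists_exposed_edge_up {S : Finset (Fin 3 → ℝ)} {v φ g : Fin 3 → ℝ} (hv : v ∈ S)
    (hexp : ∀ s ∈ S, s ≠ v → φ ⬝ᵥ s < φ ⬝ᵥ v) (hup : ∃ s ∈ S, g ⬝ᵥ v < g ⬝ᵥ s) :
    ∃ lam : ℝ, 0 < lam ∧ ∃ w ∈ S, g ⬝ᵥ v < g ⬝ᵥ w ∧
      (φ + lam • g) ⬝ᵥ w = (φ + lam • g) ⬝ᵥ v ∧
      (∀ s ∈ S, (φ + lam • g) ⬝ᵥ s ≤ (φ + lam • g) ⬝ᵥ v) ∧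
      (∀ s ∈ S, (φ + lam • g) ⬝ᵥ s = (φ + lam • g) ⬝ᵥ v → s = v ∨ g ⬝ᵥ v < g ⬝ᵥ s) := by
  classical
  -- the candidates and their critical parameters
  set U := S.filter fun s => g ⬝ᵥ v < g ⬝ᵥ s with hU
  have hUne : U.Nonempty := by
    obtain ⟨s, hs, hgs⟩ := hup
    exact ⟨s, Finset.mem_filter.2 ⟨hs, hgs⟩⟩
  let crit : (Fin 3 → ℝ) → ℝ := fun s => (φ ⬝ᵥ v - φ ⬝ᵥ s) / (g ⬝ᵥ s - g ⬝ᵥ v)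
  obtain ⟨w, hwU, hwmin⟩ := U.exists_min_image crit hUne
  obtain ⟨hwS, hgw⟩ := Finset.mem_filter.1 hwU
  have hwv : w ≠ v := by rintro rfl; exact lt_irrefl _ hgw
  have hcritpos : ∀ s ∈ U, 0 < crit s := by
    intro s hs
    obtain ⟨hsS, hgs⟩ := Finset.mem_filter.1 hs
    have hsv : s ≠ v := by rintro rfl; exact lt_irrefl _ hgs
    exact div_pos (sub_pos.2 (hexp s hsS hsv)) (sub_pos.2 hgs)
  refine ⟨crit w, hcritpos w hwU, w, hwS, hgw, ?_, ?_, ?_⟩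
  · -- `ψ w = ψ v`
    have hgw' : g ⬝ᵥ w - g ⬝ᵥ v ≠ 0 := (sub_pos.2 hgw).ne'
    simp only [add_dotProduct, smul_dotProduct, smul_eq_mul, crit]
    field_simp
    ring
  · intro s hs
    simp only [add_dotProduct, smul_dotProduct, smul_eq_mul]
    by_cases hsv : s = v
    · rw [hsv]
    by_cases hgs : g ⬝ᵥ v < g ⬝ᵥ s
    · -- `crit w ≤ crit s`
      have hle := hwmin s (Finset.mem_filter.2 ⟨hs, hgs⟩)
      have hden : 0 < g ⬝ᵥ s - g ⬝ᵥ v := sub_pos.2 hgs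
      have : crit w * (g ⬝ᵥ s - g ⬝ᵥ v) ≤ φ ⬝ᵥ v - φ ⬝ᵥ s := by
        calc crit w * (g ⬝ᵥ s - g ⬝ᵥ v) ≤ crit s * (g ⬝ᵥ s - g ⬝ᵥ v) :=
              mul_le_mul_of_nonneg_right hle hden.le
          _ = φ ⬝ᵥ v - φ ⬝ᵥ s := div_mul_cancel₀ _ hden.ne'
      nlinarith
    · push Not at hgs
      have h1 := hexp s hs hsv
      have h2 : crit w * g ⬝ᵥ s ≤ crit w * g ⬝ᵥ v :=
        mul_le_mul_of_nonneg_left hgs (hcritpos w hwU).le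
      linarith
  · intro s hs heq
    by_cases hsv : s = v
    · exact Or.inl hsv
    right
    by_contra hgs
    push Not at hgs
    simp only [add_dotProduct, smul_dotProduct, smul_eq_mul] at heq
    have h1 := hexp s hs hsv
    have h2 : crit w * g ⬝ᵥ s ≤ crit w * g ⬝ᵥ v :=
      mul_le_mul_of_nonneg_left hgs (hcritpos w hwU).le
    linarith

/-! ### Perturbation: the top point of a face is a vertex -/

/-- **Perturbation lemma.** If `ψ` is maximal on `S` at `x` and `x` is the strict
`g`-maximiser among the points of `S` at the top level of `ψ`, then `x` is the strict maximiser of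
`ψ + ε g` on `S` for all sufficiently small `ε > 0`. [folklore] -/
theorem exists_strict_max_perturb {S : Finset (Fin 3 → ℝ)} {ψ g x : Fin 3 → ℝ}
    (hψ : ∀ s ∈ S, ψ ⬝ᵥ s ≤ ψ ⬝ᵥ x)
    (hg : ∀ s ∈ S, ψ ⬝ᵥ s = ψ ⬝ᵥ x → s ≠ x → g ⬝ᵥ s < g ⬝ᵥ x) :
    ∃ ε₀ : ℝ, 0 < ε₀ ∧ ∀ ε : ℝ, 0 < ε → ε ≤ ε₀ →
      ∀ s ∈ S, s ≠ x → (ψ + ε • g) ⬝ᵥ s < (ψ + ε • g) ⬝ᵥ x := by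
  classical
  -- points strictly below in `ψ`: a uniform gap `δ` and a bound `B` on `g s - g x`
  set L := S.filter fun s => ψ ⬝ᵥ s < ψ ⬝ᵥ x with hL
  by_cases hLne : L.Nonempty
  · obtain ⟨s₀, hs₀, hs₀max⟩ := L.exists_max_image (fun s => ψ ⬝ᵥ s) hLne
    set δ := ψ ⬝ᵥ x - ψ ⬝ᵥ s₀ with hδ
    have hδpos : 0 < δ := sub_pos.2 (Finset.mem_filter.1 hs₀).2
    obtain ⟨s₁, -, hs₁max⟩ := L.exists_max_image (fun s => g ⬝ᵥ s - g ⬝ᵥ x) hLne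
    set B := max (g ⬝ᵥ s₁ - g ⬝ᵥ x) 1 with hB
    have hBpos : 0 < B := lt_of_lt_of_le one_pos (le_max_right _ _)
    refine ⟨δ / (2 * B), div_pos hδpos (by positivity), fun ε hε hεle s hs hsx => ?_⟩
    simp only [add_dotProduct, smul_dotProduct, smul_eq_mul]
    by_cases hlt : ψ ⬝ᵥ s < ψ ⬝ᵥ x
    · have hsL : s ∈ L := Finset.mem_filter.2 ⟨hs, hlt⟩
      have h1 : ψ ⬝ᵥ s ≤ ψ ⬝ᵥ s₀ := hs₀max s hsL
      have h2 : g ⬝ᵥ s - g ⬝ᵥ x ≤ B := (hs₁max s hsL).trans (le_max_left _ _)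
      have h3 : ε * (g ⬝ᵥ s - g ⬝ᵥ x) ≤ ε * B := mul_le_mul_of_nonneg_left h2 hε.le
      have h4 : ε * B ≤ δ / (2 * B) * B := mul_le_mul_of_nonneg_right hεle hBpos.le
      have h5 : δ / (2 * B) * B = δ / 2 := by field_simp
      nlinarith
    · have heq : ψ ⬝ᵥ s = ψ ⬝ᵥ x := le_antisymm (hψ s hs) (not_lt.1 hlt)
      have := hg s hs heq hsx
      nlinarith
  · -- every point of `S` is at the top level of `ψ`
    refine ⟨1, one_pos, fun ε hε _ s hs hsx => ?_⟩
    have heq : ψ ⬝ᵥ s = ψ ⬝ᵥ x := by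
      by_contra hne
      exact hLne ⟨s, Finset.mem_filter.2 ⟨hs, lt_of_le_of_ne (hψ s hs) hne⟩⟩
    have := hg s hs heq hsx
    simp only [add_dotProduct, smul_dotProduct, smul_eq_mul]
    nlinarith

/-! ### Lemma 4.5, combinatorial part: the first pairs on an exposed collinear set -/

/-- **Lemma 4.5, first pair.** Let `ψ` attain its maximum `ψ n₁ > 0` on `S` only at points of
the ray `n₁ + θ e` (`θ ≥ 0`, `ψ e = 0`), and let `θ₂ > 0` be the smallest positive parameter of a
point of `S` on the ray. Then `(n₁, n₁ + θ₂ e)` is simply interacting: the sum is not in `S`, and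
`n₃ + n₄ = n₁ + (n₁ + θ₂ e)` with `n₃ ≠ n₄ ∈ S` only for `{n₃, n₄} = {n₁, n₁ + θ₂ e}` ("the two
segments have the common middle point"). [cite: KishimotoYoneda2022, §4 proof of Lemma 4.5] -/
theorem sip_endpoint_next {S : Finset (Fin 3 → ℝ)} {ψ n₁ e : Fin 3 → ℝ} {θ₂ : ℝ}
    (hM : 0 < ψ ⬝ᵥ n₁) (hmax : ∀ s ∈ S, ψ ⬝ᵥ s ≤ ψ ⬝ᵥ n₁)
    (hray : ∀ s ∈ S, ψ ⬝ᵥ s = ψ ⬝ᵥ n₁ → ∃ θ : ℝ, 0 ≤ θ ∧ s = n₁ + θ • e)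
    (he : ψ ⬝ᵥ e = 0) (he0 : e ≠ 0)
    (hfirst : ∀ θ : ℝ, 0 < θ → n₁ + θ • e ∈ S → θ₂ ≤ θ) :
    n₁ + (n₁ + θ₂ • e) ∉ S ∧ ∀ n₃ ∈ S, ∀ n₄ ∈ S, n₃ ≠ n₄ → n₃ + n₄ = n₁ + (n₁ + θ₂ • e) →
      (n₃ = n₁ ∧ n₄ = n₁ + θ₂ • e) ∨ (n₃ = n₁ + θ₂ • e ∧ n₄ = n₁) := by
  have hψe : ∀ θ : ℝ, ψ ⬝ᵥ (n₁ + θ • e) = ψ ⬝ᵥ n₁ := fun θ => by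
    rw [dotProduct_add, dotProduct_smul, he, smul_zero, add_zero]
  refine ⟨fun hmem => ?_, fun n₃ h₃ n₄ h₄ h34 hsum => ?_⟩
  · have := hmax _ hmem
    rw [dotProduct_add, hψe] at this
    linarith
  · have hs : ψ ⬝ᵥ n₃ + ψ ⬝ᵥ n₄ = 2 * ψ ⬝ᵥ n₁ := by
      rw [← dotProduct_add, hsum, dotProduct_add, hψe]; ring
    have e₃ : ψ ⬝ᵥ n₃ = ψ ⬝ᵥ n₁ := le_antisymm (hmax _ h₃) (by linarith [hmax _ h₄])
    have e₄ : ψ ⬝ᵥ n₄ = ψ ⬝ᵥ n₁ := by linarith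
    obtain ⟨θ₃, hθ₃, rfl⟩ := hray n₃ h₃ e₃
    obtain ⟨θ₄, hθ₄, rfl⟩ := hray n₄ h₄ e₄
    have hθ : θ₃ + θ₄ = θ₂ := by
      have : n₁ + (n₁ + (θ₃ + θ₄) • e) = n₁ + (n₁ + θ₂ • e) := by
        rw [← hsum, add_smul]; abel
      have h' : (θ₃ + θ₄ - θ₂) • e = 0 := by
        rw [sub_smul, sub_eq_zero]; exact add_left_cancel (add_left_cancel this)
      exact sub_eq_zero.1 ((smul_eq_zero.1 h').resolve_right he0)
    rcases hθ₃.lt_or_eq with h3pos | h3zero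
    · rcases hθ₄.lt_or_eq with h4pos | h4zero
      · exfalso
        have := hfirst θ₃ h3pos h₃
        linarith
      · right
        subst h4zero
        refine ⟨by rw [show θ₃ = θ₂ by linarith], by simp⟩
    · left
      subst h3zero
      refine ⟨by simp, by rw [show θ₄ = θ₂ by linarith]⟩

/-- **Lemma 4.5, second pair.** In the same situation let `θ₃ > θ₂` be the second smallest
positive parameter. Then `(n₁, n₁ + θ₃ e)` is simply interacting as well ("it is only `n₂` that is
in `S ∩ E` and between `n₁, n₃`"). [cite: KishimotoYoneda2022, §4 proof of Lemma 4.5 (ii)] -/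
theorem sip_endpoint_second {S : Finset (Fin 3 → ℝ)} {ψ n₁ e : Fin 3 → ℝ} {θ₂ θ₃ : ℝ}
    (hM : 0 < ψ ⬝ᵥ n₁) (hmax : ∀ s ∈ S, ψ ⬝ᵥ s ≤ ψ ⬝ᵥ n₁)
    (hray : ∀ s ∈ S, ψ ⬝ᵥ s = ψ ⬝ᵥ n₁ → ∃ θ : ℝ, 0 ≤ θ ∧ s = n₁ + θ • e)
    (he : ψ ⬝ᵥ e = 0) (he0 : e ≠ 0)
    (hsecond : ∀ θ : ℝ, 0 < θ → θ ≠ θ₂ → n₁ + θ • e ∈ S → θ₃ ≤ θ) :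
    n₁ + (n₁ + θ₃ • e) ∉ S ∧ ∀ n₃ ∈ S, ∀ n₄ ∈ S, n₃ ≠ n₄ → n₃ + n₄ = n₁ + (n₁ + θ₃ • e) →
      (n₃ = n₁ ∧ n₄ = n₁ + θ₃ • e) ∨ (n₃ = n₁ + θ₃ • e ∧ n₄ = n₁) := by
  have hψe : ∀ θ : ℝ, ψ ⬝ᵥ (n₁ + θ • e) = ψ ⬝ᵥ n₁ := fun θ => by
    rw [dotProduct_add, dotProduct_smul, he, smul_zero, add_zero]
  refine ⟨fun hmem => ?_, fun n₃ h₃ n₄ h₄ h34 hsum => ?_⟩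
  · have := hmax _ hmem
    rw [dotProduct_add, hψe] at this
    linarith
  · have hs : ψ ⬝ᵥ n₃ + ψ ⬝ᵥ n₄ = 2 * ψ ⬝ᵥ n₁ := by
      rw [← dotProduct_add, hsum, dotProduct_add, hψe]; ring
    have e₃ : ψ ⬝ᵥ n₃ = ψ ⬝ᵥ n₁ := le_antisymm (hmax _ h₃) (by linarith [hmax _ h₄])
    have e₄ : ψ ⬝ᵥ n₄ = ψ ⬝ᵥ n₁ := by linarith
    obtain ⟨θ, hθ, rfl⟩ := hray n₃ h₃ e₃
    obtain ⟨θ', hθ', rfl⟩ := hray n₄ h₄ e₄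
    have hθs : θ + θ' = θ₃ := by
      have : n₁ + (n₁ + (θ + θ') • e) = n₁ + (n₁ + θ₃ • e) := by
        rw [← hsum, add_smul]; abel
      have h' : (θ + θ' - θ₃) • e = 0 := by
        rw [sub_smul, sub_eq_zero]; exact add_left_cancel (add_left_cancel this)
      exact sub_eq_zero.1 ((smul_eq_zero.1 h').resolve_right he0)
    rcases hθ.lt_or_eq with hpos | hzero
    · rcases hθ'.lt_or_eq with hpos' | hzero'
      · exfalso
        -- both parameters are positive and sum to `θ₃`: each is `θ₂` or at least `θ₃`
        by_cases ht : θ = θ₂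
        · by_cases ht' : θ' = θ₂
          · exact h34 (by rw [ht, ht'])
          · have := hsecond θ' hpos' ht' h₄
            linarith
        · have := hsecond θ hpos ht h₃
          linarith
      · right
        subst hzero'
        refine ⟨by rw [show θ = θ₃ by linarith], by simp⟩
    · left
      subst hzero
      refine ⟨by simp, by rw [show θ' = θ₃ by linarith]⟩

end KY

end Literature.Analysis.FluidPDE
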